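import Summits.BirchSwinnertonDyer.BirchSwinnertonDyer.Theorems.PrintCFramBottomClassIndexLawFiveLeCuspCutFormAssembly
import Summits.BirchSwinnertonDyer.BirchSwinnertonDyer.Theorems.PrintCFramBottomClassIndexLawFiveLeCuspSeedCutSummability
import Summits.BirchSwinnertonDyer.BirchSwinnertonDyer.Theorems.PrintCFramBottomClassIndexLawFiveLeCuspSeedCutResidue
import Summits.BirchSwinnertonDyer.BirchSwinnertonDyer.Theorems.PrintCFramBottomClassIndexLawFiveLeCuspSeedCuspValueSquaredVehicle
import Summits.BirchSwinnertonDyer.BirchSwinnertonDyer.Theorems.PrintCFramBottomClassIndexLawFiveLeCohenCutKronecker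
import HarnessLib

set_option autoImplicit false

/-!
# Crux `PrintCFram.BottomClassIndexLawFiveLe` (stmt-BirchSwinnertonDyer-20372), line `eisenstein-resource-bdp-line` (registry v25 → v26):
# THE CUSP RUNG IS PRINT BY NAME — `cuspCutForm_six_of_facts : NF-A → NF-Q → (CuspCutForm⁶)`, the instantiation of (ζ)
# `CuspGlue.cuspCutForm_six_of_sockets` with its analytic hypothesis family DISCHARGED by the landed kernel theorems of seats
# w5 g6 ((R2) summability, (R4) residue of the cut Cohen `L`-series) and w2 g13 ((β) the transcendental constant)
# (cell `bsd-print-cfram`, width seat `bsd-line-cfram-p1-w8` g8; THEOREMS ONLY, `--supports` 20372; BSD is not proved by any of this)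

HONEST FRAMING. Nothing here is a statement about elliptic curves or BSD. The registered `stub_cuspCutForm` of v24/v25 (= `hcut` of
`CuspSeed.cuspSeed_six_of_cutForm`, p688228; «PRINT-DERIVABLE in q-expansion currency») becomes a THEOREM modulo exactly two cite-only
named facts — Cohen 1975 Thm 3.1 (`Cohen1975.thm31_cohenSeries_mem_halfIntModularForms`, NF-A) and Katz 1973 Cor. 1.6.2 at all cusps
(`Katz1973_qExpansionPrinciple_allCusps`, NF-Q) — by feeding (ζ) `cuspCutForm_six_of_sockets` (p700065) with, per class datum
`(p, m, χ, k)`: `s := χ(−1) ∈ {±1}` (`PrimitiveQuadratic.exists_sign_eq_of_charZero`), `e := s·m` fundamental-or-1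
(`CohenCut.sign_mul_eq_one_or_isFundamental`, w4 g12), `|e| = m`, `(−1)^k m = −e` (the parity clause); (hsum) :=
`CuspSeed.LSeriesSummable_ite_cut_cohenH` (w5 g6, R2); (hR) := `CuspSeed.tendsto_sub_mul_LSeries_ite_cut_cohenH` (w5 g6, R4) with its
residue `R`; (hβ) := `CuspGlue.exists_cuspUnit_sq_eq_of_vehicle_sockets` (w2 g13, (β) part 3) through `weight_cast_sub_half`.
The certificate `cuspSeed_six_of_facts` composes with `CuspSeed.cuspSeed_six_of_cutForm` (typechecks ⟺ the registered text verbatim).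
LEAD g13 05:25:13Z: on acceptance v26 merges `stub_cuspCutForm` into the cite-only bundle `stub_printsCohenKatzCusps := NF-A ∧ Katz ∧ NF-Q`.
No registered stub is closed BY THIS FILE (that is the registry's `_of`, LEAD). beyond-print theorem: NO.

References: [Cohen1975] Thm. 3.1; [Katz1973] §1.6 Cor. 1.6.2; crux notes `Lines/eisenstein-resource-bdp-line-w8g8-notes.md` §1,
`…-w5g5-cusp-seed.md` §§0–5, 14–15; `…-lead-g13.md`.
-/

-- summit-side namespace `Summit.BirchSwinnertonDyer.BirchSwinnertonDyer.…` (single-conjunct summit, D-0017 layout)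
set_option linter.dupNamespace false

noncomputable section

open scoped Classical MatrixGroups NumberTheorySymbols ModularForm Manifold Topology Real Nat

open UpperHalfPlane hiding I
open Complex Filter Function PowerSeries
open Literature.NumberTheory.EllipticCurves.ModularForms

namespace Summit.BirchSwinnertonDyer.BirchSwinnertonDyer.Theorems.PrintCFram.CuspGlue

open Summit.BirchSwinnertonDyer.BirchSwinnertonDyer.Theorems.PrintCFram
open Literature.NumberTheory.EllipticCurves.Tunnell1983
open Literature.NumberTheory.ModularForms.CohenEisenstein (cohenH)
open Literature.NumberTheory.ModularForms
open DirichletCharacter Literature.NumberTheory.LFunctions Literature.NumberTheory.EllipticCurves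
  Literature.NumberTheory.EllipticCurves.KrizLi2019 Literature.NumberTheory.QuadraticFields NumberField

/-! ## §1 The class datum's fundamental discriminant `e = χ(−1)·m` and the parity clause as `(−1)^k m = −e` -/

/-- From the parity clause `χ(−1)·(−1)^k = −1` (in `ℚ_p`) and `χ(−1) = s ∈ {±1}`: `(−1)^k · m = −(s·m)` in `ℤ`. [folklore] -/
theorem neg_one_pow_mul_eq_neg_sign_mul {p : ℕ} [Fact p.Prime] {m : ℕ} {χval : ℚ_[p]} {s : ℤ} (hs : χval = (s : ℚ_[p]))
    (hs1 : s = 1 ∨ s = -1) {k : ℕ} (hpar : χval * (-1) ^ k = -1) : (-1 : ℤ) ^ k * m = -(s * m) := by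
  have h1 : ((s * (-1) ^ k : ℤ) : ℚ_[p]) = ((-1 : ℤ) : ℚ_[p]) := by
    push_cast
    rw [← hs]
    exact hpar
  have h2 : s * (-1) ^ k = -1 := by exact_mod_cast h1
  rcases hs1 with rfl | rfl
  · rw [one_mul] at h2; rw [h2]; ring
  · have : (-1 : ℤ) ^ k = 1 := by linarith
    rw [this]; ring

/-! ## §2 `cuspCutForm_six_of_facts` -/

/-- **(CuspCutForm⁶) FROM THE TWO CITE-ONLY FACTS.** The registered text of v24/v25's `stub_cuspCutForm` — for every class datum at the
six leaf primes, a field `𝔽` of characteristic `p`, `ι : ℤ_p → 𝔽` and `G ∈ 𝔽⟦q⟧` supported on the (3,0)-`m`-cut with the Cohen dictionary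
and the cusp conjunct «`G = 0 ⟹ ∀ x, ↑x = ↑C → ι x = 0`» — from NF-A (Cohen 1975 Thm 3.1) and NF-Q (Katz 1973 Cor. 1.6.2 at all cusps),
everything else being landed kernel theorems: (ζ) `cuspCutForm_six_of_sockets` fed with w5 g6's (R2) `CuspSeed.LSeriesSummable_ite_cut_cohenH`,
(R4) `CuspSeed.tendsto_sub_mul_LSeries_ite_cut_cohenH` and w2 g13's `exists_cuspUnit_sq_eq_of_vehicle_sockets`, at `e = χ(−1)·m`.
[cite: Cohen1975, Thm. 3.1] [cite: Katz1973, §1.6 Cor. 1.6.2] -/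
theorem cuspCutForm_six_of_facts
    (hA : Cohen1975.thm31_cohenSeries_mem_halfIntModularForms)
    (hQ : Katz1973_qExpansionPrinciple_allCusps) :
    ∀ (p : ℕ) [Fact p.Prime] (m : ℕ) [NeZero m] (χ : DirichletCharacter ℚ_[p] m) (k : ℕ),
      (p = 7 ∨ p = 11 ∨ p = 19 ∨ p = 43 ∨ p = 67 ∨ p = 163) →
      m.Coprime p → χ.IsPrimitive → χ.IsQuadratic → (k = (p + 1) / 4 ∨ k = (3 * p - 1) / 4) →
      2 ≤ k → k ≤ p - 2 → χ (-1) * (-1) ^ k = -1 →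
      ∃ (𝔽 : Type) (_ : Field 𝔽) (_ : CharP 𝔽 p) (ι : ℤ_[p] →+* 𝔽) (G : PowerSeries 𝔽),
        (∀ a : ℕ, coeff a G ≠ 0 →
          m ∣ a ∧ a / m % 4 = 3 ∧ (∀ q : ℕ, q.Prime → q ∣ m → q ≠ 2 → jacobiSym (-((a / m : ℕ) : ℤ)) q = 1) ∧
            (2 ∣ m → a / m % 8 = 7) ∧ ¬ 3 ∣ a / m) ∧
        (∀ (n₀ f : ℕ) (K : Type) [Field K] [NumberField K] (εK : DirichletCharacter ℚ_[p] (NumberField.discr K).natAbs),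
          Squarefree n₀ → n₀ % 4 = 3 → 0 < f →
          (m ∣ m * (n₀ * f ^ 2) ∧ m * (n₀ * f ^ 2) / m % 4 = 3 ∧
            (∀ q : ℕ, q.Prime → q ∣ m → q ≠ 2 → jacobiSym (-((m * (n₀ * f ^ 2) / m : ℕ) : ℤ)) q = 1) ∧
            (2 ∣ m → m * (n₀ * f ^ 2) / m % 8 = 7) ∧ ¬ 3 ∣ m * (n₀ * f ^ 2) / m) →
          IsImaginaryQuadratic K → NumberField.discr K = -(n₀ : ℤ) → IsKroneckerCharacterOf K εK →
          ∃ (t : ℤ) (x : ℤ_[p]), (f = 1 → t = 1) ∧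
            (x : ℚ_[p]) = (k : ℚ_[p])⁻¹ * @generalizedBernoulli ℚ_[p] _ _
              (changeLevel (dvd_mul_right m (NumberField.discr K).natAbs) χ *
                changeLevel (dvd_mul_left (NumberField.discr K).natAbs m) εK).conductor ⟨conductor_ne_zero _⟩ k
              (changeLevel (dvd_mul_right m (NumberField.discr K).natAbs) χ *
                changeLevel (dvd_mul_left (NumberField.discr K).natAbs m) εK).primitiveCharacter ∧
            coeff (m * (n₀ * f ^ 2)) G = (t : 𝔽) * ι x) ∧
        (G = 0 → ∀ x : ℤ_[p], (x : ℚ_[p]) =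
          ((bernoulli (2 * k) / (k.factorial : ℚ) * (m : ℚ) ^ (k - 1) *
            ∏ q ∈ m.primeFactors, ((q : ℚ) - 1) * ((q : ℚ) ^ (2 * k) - 1) / (q : ℚ) ^ (2 * k + 1) : ℚ) : ℚ_[p]) →
          ι x = 0) := by
  refine cuspCutForm_six_of_sockets hA hQ fun p _ m _ χ k hp6 hmp hχ hχq hk hk2 hkp hpar ↦ ?_
  have h5 : 5 ≤ p := by rcases hp6 with h | h | h | h | h | h <;> omega
  have hk0 : k ≠ 0 := by omega
  have hkp' : k ≤ p := by omega
  have hpm : ¬ p ∣ m := fun h ↦ by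
    have := Nat.Coprime.eq_one_of_dvd (Nat.Coprime.symm hmp) h
    have hp1 := (Fact.out : p.Prime).one_lt
    omega
  -- the sign `s = χ(−1)` and the fundamental discriminant `e = s·m`
  obtain ⟨s, hs1, hs⟩ := PrimitiveQuadratic.exists_sign_eq_of_charZero χ
  have hs1' : s = 1 ∨ s = -1 := hs1.elim (fun h ↦ Or.inl h.1) (fun h ↦ Or.inr h.1)
  have he := CohenCut.sign_mul_eq_one_or_isFundamental hχ hχq hs hs1'
  have hme : (s * m : ℤ).natAbs = m := by
    rcases hs1' with rfl | rfl <;> simp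
  have hsign : (-1 : ℤ) ^ k * m = -(s * m) := neg_one_pow_mul_eq_neg_sign_mul hs hs1' hpar
  refine ⟨_, fun s' hs' ↦ ?_, CuspSeed.tendsto_sub_mul_LSeries_ite_cut_cohenH he hme hk2 hsign, fun v Λ ℓ hΛ hℓ hE ↦
    exists_cuspUnit_sq_eq_of_vehicle_sockets h5 hk0 hkp' hpm hΛ hℓ (by rw [weight_cast_sub_half]; exact hE)⟩
  exact CuspSeed.LSeriesSummable_ite_cut_cohenH he hme hk2 hsign (by simpa using hs')

/-- **Certificate**: (CuspSeed⁶) from NF-A and NF-Q, by composing `cuspCutForm_six_of_facts` with `CuspSeed.cuspSeed_six_of_cutForm`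
(p688228), whose hypothesis is the registered `stub_cuspCutForm` text — typechecks ⟺ verbatim. [cite: Cohen1975, Thm. 3.1]
[cite: Katz1973, §1.6 Cor. 1.6.2] -/
theorem cuspSeed_six_of_facts
    (hA : Cohen1975.thm31_cohenSeries_mem_halfIntModularForms)
    (hQ : Katz1973_qExpansionPrinciple_allCusps) :
    ∀ (p : ℕ) [Fact p.Prime] (m : ℕ) [NeZero m] (χ : DirichletCharacter ℚ_[p] m) (k : ℕ),
      (p = 7 ∨ p = 11 ∨ p = 19 ∨ p = 43 ∨ p = 67 ∨ p = 163) →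
      m.Coprime p → χ.IsPrimitive → χ.IsQuadratic → (k = (p + 1) / 4 ∨ k = (3 * p - 1) / 4) →
      2 ≤ k → k ≤ p - 2 → χ (-1) * (-1) ^ k = -1 →
      ¬ (∃ ℓ : ℕ, ℓ.Prime ∧ ℓ ∣ m ∧ (ℓ % p = 1 ∨ ℓ % p = p - 1)) →
      ∃ (K₀ : Type) (_ : Field K₀) (_ : NumberField K₀) (ε₀ : DirichletCharacter ℚ_[p] (NumberField.discr K₀).natAbs),
        IsImaginaryQuadratic K₀ ∧
        (∀ q : ℕ, q.Prime → q ∣ m → ((Ideal.span {(q : ℤ)}).primesOver (𝓞 K₀)).ncard = 2) ∧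
        Odd (NumberField.discr K₀) ∧ NumberField.discr K₀ < -4 ∧ IsKroneckerCharacterOf K₀ ε₀ ∧
        ¬ ‖(k : ℚ_[p])⁻¹ * @generalizedBernoulli ℚ_[p] _ _
            (changeLevel (dvd_mul_right m (NumberField.discr K₀).natAbs) χ *
              changeLevel (dvd_mul_left (NumberField.discr K₀).natAbs m) ε₀).conductor ⟨conductor_ne_zero _⟩ k
            (changeLevel (dvd_mul_right m (NumberField.discr K₀).natAbs) χ *
              changeLevel (dvd_mul_left (NumberField.discr K₀).natAbs m) ε₀).primitiveCharacter‖ ≤ (p : ℝ)⁻¹ :=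
  CuspSeed.cuspSeed_six_of_cutForm (cuspCutForm_six_of_facts hA hQ)

end Summit.BirchSwinnertonDyer.BirchSwinnertonDyer.Theorems.PrintCFram.CuspGlue

end
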